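import Summits.CriticalPhenomena.PercolationContinuityZ3.Theorems.PercShatteringRaceNearLinearTwoClusterDecayConsumedBoxLRO
import Literature.Probability.Percolation.SeedLemma
import HarnessLib

/-!
# Crux `PercShatteringRace.NearLinearTwoClusterDecay` (stmt-CriticalPhenomena-5785) — split glue, CORE (density sampling)

Helper file of the lead (seat c4) of the line `pair-decay-long-arms-dense`
(`Cruxes/NearLinearTwoClusterDecay/Lines/pair_decay_long_arms_dense.lean`, crux-strategist 2026-08-17);
lands with `--supports stmt-CriticalPhenomena-5785` (registered stub
`tendsto_twoCluster_of_pairDecay_of_noThinWitness'`).  The headline glue theorems with the two proposed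
sub-cruxes INLINED (`nearLinearTwoClusterDecay_of_subs`, the consumed side, necessity, the lossless cut)
are in the sequel `PercShatteringRaceNearLinearTwoClusterDecaySplit.lean`.

The union-form crux `U(1/6)` ("two distinct in-box crossing clusters of `(Λ(n), Λ(⌈n^{7/6}⌉))`") is
composed, with NO shell product and NO case split on `θ(p_c)`, from
* the PAIR form (child `PairTwoArmsDecay`): for a deterministic pair `x, x' ∈ Λ(n)` the probability of
  `pairBad m x x'` (both reach `∂ⁱⁿΛ(m)` inside `Λ(m)`, not joined inside `Λ(m)`) is eventually `≤ ε`;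
* the residue (child `LongArmsAreDense`, through its consequence "no thin witness"): a bad pair never
  has a witness whose `Λ(m)`-cluster is `κ`-thin in `Λ(n)`;
by DENSITY SAMPLING: on the crux event either a witness is `κ`-thin, or both witnesses are `κ`-dense
and then (inheritance `pairBad_of_conn`) every pair of their traces is bad, so there are
`≥ (κ|Λ(n)|)²` ordered bad pairs; Markov on the bad-pair count (`pairCountBound`) and the pair form at
`ε κ²` bound this by `ε` (`eventually_twoCluster_le`, `tendsto_twoCluster_of_pairDecay_of_noThinWitness'`).
Deterministic core and Markov step adapted from `Cruxes/…/TriageWorldsSplit_r2_1.lean` (triager r2-1)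
with the `0 < θ(p_c)` guards removed (crux-strategist); no new mathematics beyond bookkeeping.
-/

noncomputable section

namespace Summit.CriticalPhenomena.PercolationContinuityZ3.Theorems.NearLinearTwoClusterDecaySplit

open MeasureTheory Filter Topology
open Literature.Probability.LatticeModels Literature.Probability.Percolation
open Summit.CriticalPhenomena.PercolationContinuityZ3.Theses.PercShatteringRace

/-! ## Vocabulary (file-local abbreviations; the landed theorems below are stated WITHOUT them) -/

/-- The critical bond measure `P_{p_c}` on `ℤ³`. [folklore] -/
abbrev Pc : Measure (BondConfig (Site 3)) := bondPercolation (zdGraph 3) (criticalProbI 3)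

/-- The crux's outer radius `m = ⌈n^{7/6}⌉`. [folklore] -/
def outer (n : ℕ) : ℕ := ⌈(n : ℝ) ^ ((7 : ℝ) / 6)⌉₊

/-- `x` reaches `∂ⁱⁿΛ(m)` inside `Λ(m)` (an in-box arm from `x`). [folklore] -/
def reachesOut (m : ℕ) (x : Site 3) : Set (BondConfig (Site 3)) :=
  {ω | ∃ y ∈ innerBoundary (zdGraph 3) (box 3 m), ω ∈ openConnIn ↑(box 3 m) x y}

/-- Cerf's two-arms event for the deterministic pair `(x, x')` in `Λ(m)`: both reach `∂ⁱⁿΛ(m)`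
inside `Λ(m)` and they are not joined inside `Λ(m)` (arXiv:1306.3105 §1). [folklore] -/
def pairBad (m : ℕ) (x x' : Site 3) : Set (BondConfig (Site 3)) :=
  reachesOut m x ∩ reachesOut m x' ∩ (openConnIn ↑(box 3 m) x x')ᶜ

/-- Union form: the crux event at inner radius `n`, outer radius `m`. [folklore] -/
def twoCluster (n m : ℕ) : Set (BondConfig (Site 3)) :=
  {ω | ∃ x ∈ box 3 n, ∃ x' ∈ box 3 n, ω ∈ pairBad m x x'}

/-- The pair event written out (as in the route items). [folklore] -/
theorem mem_pairBad_iff {m : ℕ} {x x' : Site 3} {ω : BondConfig (Site 3)} :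
    ω ∈ pairBad m x x' ↔ ∃ y ∈ innerBoundary (zdGraph 3) (box 3 m),
      ∃ y' ∈ innerBoundary (zdGraph 3) (box 3 m),
        ω ∈ openConnIn ↑(box 3 m) x y ∧ ω ∈ openConnIn ↑(box 3 m) x' y' ∧
          ω ∉ openConnIn ↑(box 3 m) x x' := by
  simp only [pairBad, reachesOut, Set.mem_inter_iff, Set.mem_setOf_eq, Set.mem_compl_iff]
  constructor
  · rintro ⟨⟨⟨y, hy, hxy⟩, ⟨y', hy', hxy'⟩⟩, hc⟩
    exact ⟨y, hy, y', hy', hxy, hxy', hc⟩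
  · rintro ⟨y, hy, y', hy', hxy, hxy', hc⟩
    exact ⟨⟨⟨y, hy, hxy⟩, ⟨y', hy', hxy'⟩⟩, hc⟩

/-- The pair event as a set-builder (the form used in the route items). [folklore] -/
theorem pairBad_eq (m : ℕ) (x x' : Site 3) : pairBad m x x' =
    {ω | ∃ y ∈ innerBoundary (zdGraph 3) (box 3 m), ∃ y' ∈ innerBoundary (zdGraph 3) (box 3 m),
      ω ∈ openConnIn ↑(box 3 m) x y ∧ ω ∈ openConnIn ↑(box 3 m) x' y' ∧
        ω ∉ openConnIn ↑(box 3 m) x x'} := by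
  ext ω
  exact mem_pairBad_iff

/-- The union-form event is the route's crux event (reshuffling the existentials). [folklore] -/
theorem twoCluster_eq (n m : ℕ) : twoCluster n m =
    {ω | ∃ x ∈ box 3 n, ∃ x' ∈ box 3 n, ∃ y ∈ innerBoundary (zdGraph 3) (box 3 m),
      ∃ y' ∈ innerBoundary (zdGraph 3) (box 3 m),
        ω ∈ openConnIn ↑(box 3 m) x y ∧ ω ∈ openConnIn ↑(box 3 m) x' y' ∧
          ω ∉ openConnIn ↑(box 3 m) x x'} := by
  ext ω
  simp only [twoCluster, Set.mem_setOf_eq, mem_pairBad_iff]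

/-- The crux unfolds to decay of `P(twoCluster n (outer n))`. [folklore] -/
theorem nearLinearTwoClusterDecay_iff_twoCluster :
    NearLinearTwoClusterDecay ↔ Tendsto (fun n : ℕ => Pc.real (twoCluster n (outer n))) atTop (𝓝 0) := by
  simp only [NearLinearTwoClusterDecay, twoCluster_eq, outer]

/-! ## The lever's deterministic core (inheritance facts + dichotomy) -/

/-- Inheritance: points joined (inside `Λ(m)`) to the two witnesses of a bad pair form a bad pair. [folklore] -/
theorem pairBad_of_conn {m : ℕ} {x x' y y' : Site 3} {ω : BondConfig (Site 3)}
    (h : ω ∈ pairBad m x x') (hy : ω ∈ openConnIn ↑(box 3 m) x y)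
    (hy' : ω ∈ openConnIn ↑(box 3 m) x' y') : ω ∈ pairBad m y y' := by
  obtain ⟨⟨⟨z, hz, hxz⟩, ⟨z', hz', hxz'⟩⟩, hc⟩ := h
  refine ⟨⟨⟨z, hz, GM.openConnIn_trans (GM.openConnIn_comm.1 hy) hxz⟩,
    ⟨z', hz', GM.openConnIn_trans (GM.openConnIn_comm.1 hy') hxz'⟩⟩, fun hyy' => hc ?_⟩
  exact GM.openConnIn_trans (GM.openConnIn_trans hy hyy') (GM.openConnIn_comm.1 hy')

open Classical in
/-- The `Λ(n)`-trace of the `Λ(m)`-cluster of `x` (Finset form). [folklore] -/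
def trace (n m : ℕ) (ω : BondConfig (Site 3)) (x : Site 3) : Finset (Site 3) :=
  (box 3 n).filter fun y => ω ∈ openConnIn ↑(box 3 m) x y

open Classical in
/-- The ordered bad pairs of `Λ(n)²`. [folklore] -/
def badPairs (n m : ℕ) (ω : BondConfig (Site 3)) : Finset (Site 3 × Site 3) :=
  (box 3 n ×ˢ box 3 n).filter fun q => ω ∈ pairBad m q.1 q.2

/-- The route items measure the trace with `Set.ncard`; it is the cardinality of `trace`. [folklore] -/
theorem ncard_eq_card_trace (n m : ℕ) (ω : BondConfig (Site 3)) (x : Site 3) :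
    Set.ncard {z : Site 3 | z ∈ box 3 n ∧ ω ∈ openConnIn ↑(box 3 m) x z} = (trace n m ω x).card := by
  classical
  rw [← Set.ncard_coe_finset]
  congr 1
  ext y
  simp [trace]

/-- Counting: on a bad pair `(x, x')`, `|trace x| · |trace x'| ≤ #badPairs`. [folklore] -/
theorem card_trace_mul_le_card_badPairs {n m : ℕ} {x x' : Site 3} {ω : BondConfig (Site 3)}
    (h : ω ∈ pairBad m x x') :
    (trace n m ω x).card * (trace n m ω x').card ≤ (badPairs n m ω).card := by
  classical
  rw [← Finset.card_product]
  refine Finset.card_le_card fun q hq => ?_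
  simp only [Finset.mem_product, trace, Finset.mem_filter] at hq
  simp only [badPairs, Finset.mem_filter, Finset.mem_product]
  exact ⟨⟨hq.1.1, hq.2.1⟩, pairBad_of_conn h hq.1.2 hq.2.2⟩

/-- Thin-arm event (child 2's event at density `κ`, outer radius `m`): some `x ∈ Λ(n)` has an in-box
arm to `∂ⁱⁿΛ(m)` while its `Λ(m)`-cluster has fewer than `κ|Λ(n)|` points in `Λ(n)`. [folklore] -/
def thinEvt (n m : ℕ) (κ : ℝ) : Set (BondConfig (Site 3)) :=
  {ω | ∃ x ∈ box 3 n, ω ∈ reachesOut m x ∧ ((trace n m ω x).card : ℝ) < κ * (box 3 n).card}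

/-- Thin-witness event (the lossless residue's event): a bad pair of `Λ(n)` with a `κ`-thin witness. [folklore] -/
def thinWitnessEvt (n m : ℕ) (κ : ℝ) : Set (BondConfig (Site 3)) :=
  {ω | ∃ x ∈ box 3 n, ∃ x' ∈ box 3 n, ω ∈ pairBad m x x' ∧ ((trace n m ω x).card : ℝ) < κ * (box 3 n).card}

/-- Dense-bad-pair event (the event bounded by Markov on the bad-pair count). [folklore] -/
def denseEvt (n m : ℕ) (κ : ℝ) : Set (BondConfig (Site 3)) :=
  {ω | ∃ x ∈ box 3 n, ∃ x' ∈ box 3 n, ω ∈ pairBad m x x' ∧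
    κ * (box 3 n).card ≤ ((trace n m ω x).card : ℝ) ∧ κ * (box 3 n).card ≤ ((trace n m ω x').card : ℝ)}

/-- The pair event is symmetric in the pair. [folklore] -/
theorem pairBad_symm {m : ℕ} {x x' : Site 3} {ω : BondConfig (Site 3)} (h : ω ∈ pairBad m x x') :
    ω ∈ pairBad m x' x :=
  ⟨⟨h.1.2, h.1.1⟩, fun h' => h.2 (GM.openConnIn_comm.1 h')⟩

/-- Dichotomy (sharp form): union form ⊆ thin witness ∪ dense bad pair. [folklore] -/
theorem twoCluster_subset_thinWitness_union_dense (n m : ℕ) (κ : ℝ) :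
    twoCluster n m ⊆ thinWitnessEvt n m κ ∪ denseEvt n m κ := by
  rintro ω ⟨x, hx, x', hx', hbad⟩
  by_cases h1 : ((trace n m ω x).card : ℝ) < κ * (box 3 n).card
  · exact Or.inl ⟨x, hx, x', hx', hbad, h1⟩
  by_cases h2 : ((trace n m ω x').card : ℝ) < κ * (box 3 n).card
  · exact Or.inl ⟨x', hx', x, hx, pairBad_symm hbad, h2⟩
  · exact Or.inr ⟨x, hx, x', hx', hbad, not_lt.1 h1, not_lt.1 h2⟩

/-- A thin witness is in particular a thin arm. [folklore] -/
theorem thinWitnessEvt_subset_thinEvt (n m : ℕ) (κ : ℝ) : thinWitnessEvt n m κ ⊆ thinEvt n m κ := by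
  rintro ω ⟨x, hx, x', -, hbad, h1⟩
  exact ⟨x, hx, hbad.1.1, h1⟩

/-- On the dense event the bad-pair count is at least `(κ|Λ(n)|)²`. [folklore] -/
theorem sq_le_card_badPairs_of_mem_denseEvt {n m : ℕ} {κ : ℝ} (hκ : 0 < κ) {ω : BondConfig (Site 3)}
    (h : ω ∈ denseEvt n m κ) : (κ * (box 3 n).card) ^ 2 ≤ ((badPairs n m ω).card : ℝ) := by
  obtain ⟨x, -, x', -, hbad, h1, h2⟩ := h
  have h0 : 0 ≤ κ * (box 3 n).card := by positivity
  calc (κ * (box 3 n).card) ^ 2 = (κ * (box 3 n).card) * (κ * (box 3 n).card) := sq _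
    _ ≤ ((trace n m ω x).card : ℝ) * ((trace n m ω x').card : ℝ) :=
        mul_le_mul h1 h2 h0 (h0.trans h1)
    _ ≤ ((badPairs n m ω).card : ℝ) := by
        exact_mod_cast card_trace_mul_le_card_badPairs hbad

/-! ## Markov on the bad-pair count (`PairCountBound`) and density sampling -/

/-- The in-box arm event is measurable (finite union of cylinder events). [folklore] -/
theorem measurableSet_reachesOut (m : ℕ) (x : Site 3) : MeasurableSet (reachesOut m x) := by
  have e : reachesOut m x = ⋃ y ∈ innerBoundary (zdGraph 3) (box 3 m), openConnIn ↑(box 3 m) x y := by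
    ext ω
    simp only [reachesOut, Set.mem_setOf_eq, Set.mem_iUnion, exists_prop]
  rw [e]
  exact Finset.measurableSet_biUnion _ fun y _ => DCT16.measurableSet_openConnIn _ x y

/-- The pair event is measurable. [folklore] -/
theorem measurableSet_pairBad (m : ℕ) (x x' : Site 3) : MeasurableSet (pairBad m x x') :=
  ((measurableSet_reachesOut m x).inter (measurableSet_reachesOut m x')).inter
    (DCT16.measurableSet_openConnIn _ x x').compl

/-- The bad-pair count as a finite sum of indicators. [folklore] -/
def badCountFn (n m : ℕ) (ω : BondConfig (Site 3)) : ℝ :=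
  ∑ q ∈ box 3 n ×ˢ box 3 n, (pairBad m q.1 q.2).indicator (1 : BondConfig (Site 3) → ℝ) ω

/-- The indicator sum is the number of ordered bad pairs. [folklore] -/
theorem badCountFn_eq_card (n m : ℕ) (ω : BondConfig (Site 3)) :
    badCountFn n m ω = (badPairs n m ω).card := by
  classical
  simp only [badCountFn, badPairs, Finset.card_filter, Set.indicator_apply, Pi.one_apply, Nat.cast_sum,
    Nat.cast_ite, Nat.cast_one, Nat.cast_zero]

/-- The bad-pair count is nonnegative. [folklore] -/
theorem badCountFn_nonneg (n m : ℕ) (ω : BondConfig (Site 3)) : 0 ≤ badCountFn n m ω := by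
  rw [badCountFn_eq_card]; positivity

/-- The bad-pair count is integrable (finite sum of indicators). [folklore] -/
theorem integrable_badCountFn (n m : ℕ) : Integrable (badCountFn n m) Pc := by
  unfold badCountFn
  refine integrable_finsetSum _ fun q _ => ?_
  exact (integrable_const (1 : ℝ)).indicator (measurableSet_pairBad m q.1 q.2)

/-- First moment of the bad-pair count: `E #badPairs = Σ_{(y,y') ∈ Λ(n)²} P(pairBad m y y')`. [folklore] -/
theorem integral_badCountFn (n m : ℕ) :
    ∫ ω, badCountFn n m ω ∂Pc = ∑ q ∈ box 3 n ×ˢ box 3 n, Pc.real (pairBad m q.1 q.2) := by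
  unfold badCountFn
  rw [integral_finsetSum]
  · refine Finset.sum_congr rfl fun q _ => ?_
    exact integral_indicator_one (measurableSet_pairBad m q.1 q.2)
  · intro q _
    exact (integrable_const (1 : ℝ)).indicator (measurableSet_pairBad m q.1 q.2)

/-- **`PairCountBound`**: Markov on the bad-pair count,
`P(dense bad pair) ≤ (κ|Λ(n)|)⁻² Σ_{(y,y') ∈ Λ(n)²} P(pairBad m y y')`. [folklore] -/
theorem pairCountBound (n m : ℕ) {κ : ℝ} (hκ : 0 < κ) :
    Pc.real (denseEvt n m κ) ≤
      ((κ * (box 3 n).card) ^ 2)⁻¹ * ∑ q ∈ box 3 n ×ˢ box 3 n, Pc.real (pairBad m q.1 q.2) := by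
  have hc : 0 < ((box 3 n).card : ℝ) := by exact_mod_cast Finset.card_pos.2 ⟨0, zero_mem_box 3 n⟩
  have hK : 0 < (κ * (box 3 n).card) ^ 2 := by positivity
  have hsub : denseEvt n m κ ⊆ {ω | (κ * (box 3 n).card) ^ 2 ≤ badCountFn n m ω} := fun ω hω => by
    rw [Set.mem_setOf_eq, badCountFn_eq_card]
    exact sq_le_card_badPairs_of_mem_denseEvt hκ hω
  have hmarkov := mul_meas_ge_le_integral_of_nonneg (μ := Pc)
    (Eventually.of_forall (badCountFn_nonneg n m)) (integrable_badCountFn n m) ((κ * (box 3 n).card) ^ 2)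
  rw [integral_badCountFn] at hmarkov
  calc Pc.real (denseEvt n m κ) ≤ Pc.real {ω | (κ * (box 3 n).card) ^ 2 ≤ badCountFn n m ω} :=
        measureReal_mono hsub
    _ ≤ ((κ * (box 3 n).card) ^ 2)⁻¹ * ∑ q ∈ box 3 n ×ˢ box 3 n, Pc.real (pairBad m q.1 q.2) := by
        rw [← div_eq_inv_mul, le_div_iff₀ hK, mul_comm]
        exact hmarkov

/-- Child 2 ⇒ the lossless residue (a thin witness is a thin arm). [folklore] -/
theorem noThinWitness'_of_longArmsDense' (h : ∀ ε : ℝ, 0 < ε → ∃ κ : ℝ, 0 < κ ∧ ∀ᶠ n : ℕ in atTop, Pc.real (thinEvt n (outer n) κ) ≤ ε) :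
    ∀ ε : ℝ, 0 < ε → ∃ κ : ℝ, 0 < κ ∧ ∀ᶠ n : ℕ in atTop, Pc.real (thinWitnessEvt n (outer n) κ) ≤ ε := by
  intro ε hε
  obtain ⟨κ, hκ, hev⟩ := h ε hε
  refine ⟨κ, hκ, ?_⟩
  filter_upwards [hev] with n hn
  exact le_trans (measureReal_mono (thinWitnessEvt_subset_thinEvt _ _ _)) hn

/-- The crux ⇒ the lossless residue (a thin-witness configuration is a crux configuration). [folklore] -/
theorem noThinWitness'_of_tendsto
    (h : Tendsto (fun n : ℕ => Pc.real (twoCluster n (outer n))) atTop (𝓝 0)) :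
    ∀ ε : ℝ, 0 < ε → ∃ κ : ℝ, 0 < κ ∧ ∀ᶠ n : ℕ in atTop, Pc.real (thinWitnessEvt n (outer n) κ) ≤ ε := by
  intro ε hε
  refine ⟨1, one_pos, ?_⟩
  have hev : ∀ᶠ n : ℕ in atTop, Pc.real (twoCluster n (outer n)) < ε := (tendsto_order.1 h).2 ε hε
  filter_upwards [hev] with n hn
  refine le_trans (measureReal_mono ?_) hn.le
  rintro ω ⟨x, hx, x', hx', hbad, -⟩
  exact ⟨x, hx, x', hx', hbad⟩

/-- **Density sampling**, quantitative core: child 1 and the residue give eventually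
`P(twoCluster n ⌈n^{7/6}⌉) ≤ 2ε`. [folklore] -/
theorem eventually_twoCluster_le (h1 : ∀ ε : ℝ, 0 < ε → ∀ᶠ n : ℕ in atTop, ∀ x ∈ box 3 n, ∀ x' ∈ box 3 n, Pc.real (pairBad (outer n) x x') ≤ ε) (h2 : ∀ ε : ℝ, 0 < ε → ∃ κ : ℝ, 0 < κ ∧ ∀ᶠ n : ℕ in atTop, Pc.real (thinWitnessEvt n (outer n) κ) ≤ ε) {ε : ℝ} (hε : 0 < ε) :
    ∀ᶠ n : ℕ in atTop, Pc.real (twoCluster n (outer n)) ≤ 2 * ε := by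
  obtain ⟨κ, hκ, hthin⟩ := h2 ε hε
  have hε' : 0 < ε * κ ^ 2 := by positivity
  filter_upwards [hthin, h1 _ hε'] with n hn2 hn1
  have hc : 0 < ((box 3 n).card : ℝ) := by exact_mod_cast Finset.card_pos.2 ⟨0, zero_mem_box 3 n⟩
  calc Pc.real (twoCluster n (outer n))
      ≤ Pc.real (thinWitnessEvt n (outer n) κ ∪ denseEvt n (outer n) κ) :=
        measureReal_mono (twoCluster_subset_thinWitness_union_dense _ _ _)
    _ ≤ Pc.real (thinWitnessEvt n (outer n) κ) + Pc.real (denseEvt n (outer n) κ) :=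
        measureReal_union_le _ _
    _ ≤ ε + ((κ * (box 3 n).card) ^ 2)⁻¹ *
          ∑ q ∈ box 3 n ×ˢ box 3 n, Pc.real (pairBad (outer n) q.1 q.2) :=
        add_le_add hn2 (pairCountBound n (outer n) hκ)
    _ ≤ ε + ((κ * (box 3 n).card) ^ 2)⁻¹ * ∑ q ∈ box 3 n ×ˢ box 3 n, ε * κ ^ 2 := by
        gcongr with q hq
        rw [Finset.mem_product] at hq
        exact hn1 q.1 hq.1 q.2 hq.2
    _ = 2 * ε := by
        rw [Finset.sum_const, Finset.card_product, nsmul_eq_mul]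
        push_cast
        field_simp
        ring

/-- **Density sampling**: child 1 ∧ residue ⇒ decay of the union-form event. [folklore] -/
theorem tendsto_twoCluster_of_pairDecay_of_noThinWitness' (h1 : ∀ ε : ℝ, 0 < ε → ∀ᶠ n : ℕ in atTop, ∀ x ∈ box 3 n, ∀ x' ∈ box 3 n, Pc.real (pairBad (outer n) x x') ≤ ε) (h2 : ∀ ε : ℝ, 0 < ε → ∃ κ : ℝ, 0 < κ ∧ ∀ᶠ n : ℕ in atTop, Pc.real (thinWitnessEvt n (outer n) κ) ≤ ε) :
    Tendsto (fun n : ℕ => Pc.real (twoCluster n (outer n))) atTop (𝓝 0) := by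
  refine Metric.tendsto_atTop.2 fun ε hε => ?_
  obtain ⟨N, hN⟩ := (eventually_twoCluster_le h1 h2 (half_pos (half_pos hε))).exists_forall_of_atTop
  refine ⟨N, fun n hn => ?_⟩
  rw [Real.dist_eq, sub_zero, abs_of_nonneg measureReal_nonneg]
  have := hN n hn
  linarith

end Summit.CriticalPhenomena.PercolationContinuityZ3.Theorems.NearLinearTwoClusterDecaySplit
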